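import Summits.NavierStokesRegularity.FluidComputer.PalasekTowerGermHostCompanionFar
import Summits.NavierStokesRegularity.FluidComputer.PalasekTowerGermHostAt

/-!
# The germ host AT ARBITRARY RATES `R`, the COMPANION RULE: a strict-slot carrier at `R` plus ANY
# far-away amplifier of speed `< Y₀(R)` is a strict-slot filler at `R` (layer L4c-i of the door port)

Cell `ns-blowup`, seat `ns-blowup-ecbridge-3` (g9); GROUP C «BRIDGE SUPPORT» of the route
`PalasekTowerBreakdown` after the RE-BASE (rev 19; live crux `EpisodeBaseT := EpisodeBaseGAt TowerRates.tuned`,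
stmt-NavierStokesRegularity-20303). The `R`-generic twin of the wide companion rule
(`PalasekTowerGermHostCompanion` XIX §2 + `PalasekTowerGermHostCompanionFar` XX, g4) for the strict slot at
the rates `R` (`Germ.LevelZeroDataAt R`, `PalasekTowerGermHostAt`, g8). LABEL: E–C typing (KERNEL
bookkeeping: slot-transfer theorems, no definition, no named fact, no `sorry`). WHAT THIS IS NOT: not
Navier–Stokes evidence — level-`0` bookkeeping of a PRESCRIBED composite profile at one instant; nothing
about any flow after `τ₀`, any crux, `RungG 1` or blow-up.

## What

The seven LOCAL fields of the slot (smooth, support, divergence free, ceiling, floor, strain, core) of a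
composite `U₁ + U₂` — carrier `U₁` with `tsupport U₁ ⊆ B̄(0, ρ₁)`, companion `U₂` outside
`B̄(0, ρ₁ + d)`, `d ≥ 1/N₀(R)`, speed `< Y₀(R)` — are read off the carrier verbatim (XIX §1 is
register-free except the core-loop transfer, re-proved here at any core radius `ε ≤ d`,
`circulation_add_of_loop_of_le`); the eighth, the STRICT ANCHOR TEST, drops by at most the far-field
pressure push `(3/(2πd⁴)) Y₀(R) ∫‖U₂‖²` (`anchor_add_far_ge`, register-free), which the carrier's positive
RISING RATE at `R` (`LevelZeroDataAt.exists_rate`: the positive minimum of `⟪U, P(ΔU − (U·∇)U)⟫` on the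
compact argmax) absorbs at large distance. Hence:

* `LevelZeroDataAt.add_far` — strict carrier at `R` with anchor values `≥ m` + far companion under the
  budget `(3/(2πd⁴)) Y₀(R) ∫‖U₂‖² < m` ⟹ `LevelZeroDataAt R (U₁ + U₂) ρ`;
* `LevelZeroDataAt.add_translate` — the same for a translate `W(· − c)` of a fixed structure `W`
  (`tsupport W ⊆ B̄(0, ρ₂)`, `ρ₁ + d + ρ₂ < ‖c‖`);
* `budget_lt_of_le_at` — the distance making the budget smaller than any `m > 0`;
* **`LevelZeroDataAt.exists_add_translate`** — for EVERY strict carrier at `R` and EVERY smooth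
  divergence-free `W` with `tsupport W ⊆ B̄(0, ρ₂)` and speed `< Y₀(R)` there is `r₀` with
  `LevelZeroDataAt R (U₁ + W(· − c)) (‖c‖ + ρ₂)` for all `‖c‖ ≥ r₀`.

References: S. Palasek, arXiv:2605.13827 §3.3 (host preparation before the first readout)
[cite: Palasek2026ElementaryModel, §3.3]; A. J. Majda, A. L. Bertozzi, *Vorticity and Incompressible
Flow* (CUP 2002), §1.8 Prop. 1.16 [cite: MajdaBertozziCUP2002, §1.8 Prop. 1.16]; D. Gilbarg,
N. S. Trudinger, *Elliptic PDE of Second Order* (2001), Lemma 4.1 [cite: GilbargTrudinger2001, Lemma 4.1].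
-/

noncomputable section

namespace Summit.NavierStokesRegularity.FluidComputer.PalasekTowerClayBridge.Germ

open Set Function Filter Topology InnerProductSpace Metric MeasureTheory Real
open scoped Topology ContDiff RealInnerProductSpace

open Literature.Analysis.FluidPDE

/-! ## §1 Core loops off a far companion, at any core radius -/

section Companion

variable {U₁ U₂ : EuclideanSpace ℝ (Fin 3) → EuclideanSpace ℝ (Fin 3)} {ρ₁ d : ℝ}

/-- **Core loops transfer (any core radius)**: a loop staying in `B̄(x, ε)` with `‖x‖ ≤ ρ₁` and `ε ≤ d`
never meets a companion living outside `B̄(0, ρ₁ + d)`, so its circulation in the composite is its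
circulation in the carrier. [folklore] -/
theorem circulation_add_of_loop_of_le (h₁s : ContDiff ℝ ∞ U₁) (h₂s : ContDiff ℝ ∞ U₂)
    (hfar : ∀ y ∈ tsupport U₂, ρ₁ + d < ‖y‖) {ε : ℝ} (hεd : ε ≤ d)
    {x : EuclideanSpace ℝ (Fin 3)} (hx : ‖x‖ ≤ ρ₁) {γ : ℝ → EuclideanSpace ℝ (Fin 3)}
    (hγ : ContDiff ℝ 1 γ) (hball : ∀ s ∈ Icc (0 : ℝ) 1, γ s ∈ closedBall x ε) :
    circulation (U₁ + U₂) γ = circulation U₁ γ := by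
  rw [circulation_add_left h₁s.continuous h₂s.continuous hγ, add_eq_left]
  unfold circulation
  rw [intervalIntegral.integral_congr (g := fun _ => (0 : ℝ)) fun s hs => ?_]
  · simp
  · have hs' : s ∈ Icc (0 : ℝ) 1 := by rwa [uIcc_of_le zero_le_one] at hs
    have hγs : ‖γ s‖ ≤ ρ₁ + d := by
      have h1 : ‖γ s - x‖ ≤ ε := mem_closedBall_iff_norm.1 (hball s hs')
      have h2 : ‖γ s‖ ≤ ‖γ s - x‖ + ‖x‖ := norm_le_norm_sub_add _ _
      linarith
    have h0 : U₂ (γ s) = 0 := image_eq_zero_of_notMem_tsupport (notMem_tsupport_of_norm_le hfar hγs)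
    simp [h0]

end Companion

/-! ## §2 The rising rate of a strict-slot filler at the rates `R` -/

namespace LevelZeroDataAt

variable {R : TowerRates} {U : EuclideanSpace ℝ (Fin 3) → EuclideanSpace ℝ (Fin 3)} {ρ : ℝ}
  (h : LevelZeroDataAt R U ρ)
include h

/-- **The anchor test values have a positive minimum on the argmax** (at the rates `R`): the argmax of
`‖U‖` is a compact subset of the support on which `⟪U, V⟫` is continuous and positive. [folklore] -/
theorem exists_rate : ∃ κ : ℝ, 0 < κ ∧ ∀ x₀, ‖U x₀‖ = R.Y 0 → κ ≤ ⟪U x₀, accel 1 U x₀⟫ := by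
  have hY := R.Y_pos 0
  set g : EuclideanSpace ℝ (Fin 3) → ℝ := fun x => ⟪U x, accel 1 U x⟫ with hg
  have hgc : Continuous g :=
    h.smooth.continuous.inner (contDiff_accel h.smooth h.confined.2 1).continuous
  set M := tsupport U ∩ {x | R.Y 0 ≤ ‖U x‖} with hM
  have hMc : IsCompact M :=
    h.confined.2.inter_right (isClosed_le continuous_const h.smooth.continuous.norm)
  have hpos : ∀ x ∈ M, 0 < g x := fun x hx => h.anchor x (le_antisymm (h.ceiling x) hx.2)
  obtain ⟨κ, hκ, hκM⟩ := hMc.exists_forall_le' (f := g) hgc.continuousOn hpos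
  refine ⟨κ, hκ, fun x₀ hx₀ => hκM x₀ ⟨?_, hx₀.ge⟩⟩
  refine subset_tsupport _ (mem_support.2 fun h0 => ?_)
  rw [h0, norm_zero] at hx₀
  linarith

end LevelZeroDataAt

/-! ## §3 The companion rule for the strict slot at `R` -/

section Slots

variable {R : TowerRates} {U₁ U₂ : EuclideanSpace ℝ (Fin 3) → EuclideanSpace ℝ (Fin 3)} {ρ₁ ρ d : ℝ}
  (h₂s : ContDiff ℝ ∞ U₂) (hdiv₂ : VectorCalculus.IsDivFree U₂)
  (h₂supp : tsupport U₂ ⊆ closedBall 0 ρ) (hρ : ρ₁ ≤ ρ)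
  (hfar : ∀ y ∈ tsupport U₂, ρ₁ + d < ‖y‖) (hdN : 1 / R.N 0 ≤ d)
  (h₂lt : ∀ x, ‖U₂ x‖ < R.Y 0)

include h₂s hdiv₂ h₂supp hρ hfar hdN h₂lt

/-- **THE COMPANION RULE AT THE RATES `R` (strict slot).** A strict-slot carrier `U₁` at `R` in
`B̄(0, ρ₁)` whose anchor values on its argmax are `≥ m`, plus a smooth divergence-free companion `U₂`
supported in `B̄(0, ρ)` outside `B̄(0, ρ₁ + d)` (`d ≥ 1/N₀(R)`), everywhere slower than `Y₀(R)`, with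
ENERGY BUDGET `(3/(2πd⁴)) Y₀(R) ∫‖U₂‖² < m`, is a strict-slot filler at `R` in `B̄(0, ρ)`.
[cite: Palasek2026ElementaryModel, §3.3] [cite: MajdaBertozziCUP2002, §1.8 Prop. 1.16] -/
theorem LevelZeroDataAt.add_far (h₁ : LevelZeroDataAt R U₁ ρ₁) {m : ℝ}
    (hm : ∀ x, ‖U₁ x‖ = R.Y 0 → m ≤ ⟪U₁ x, accel 1 U₁ x⟫)
    (hbudget : 3 / (2 * π * d ^ 4) * R.Y 0 * ∫ x, ‖U₂ x‖ ^ 2 < m) :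
    LevelZeroDataAt R (U₁ + U₂) ρ := by
  have hN := R.N_pos 0
  have hd : 0 < d := lt_of_lt_of_le (by positivity) hdN
  have h₂c : HasCompactSupport U₂ :=
    (isCompact_closedBall (0 : EuclideanSpace ℝ (Fin 3)) ρ).of_isClosed_subset (isClosed_tsupport U₂)
      h₂supp
  have hY := R.Y_pos 0
  refine ⟨h₁.smooth.add h₂s, ?_, isDivFree_add h₁.smooth h₂s h₁.divFree hdiv₂, ?_, ?_, ?_, ?_, ?_⟩
  · refine (tsupport_add U₁ U₂).trans (union_subset (h₁.support.trans ?_) h₂supp)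
    exact closedBall_subset_closedBall hρ
  · intro x
    exact (norm_add_le_max h₁.support hfar hd x).trans (max_le (h₁.ceiling x) (h₂lt x).le)
  · obtain ⟨x, hx, hfl⟩ := h₁.floor
    have hx1 : x ∈ tsupport U₁ := subset_tsupport _ (mem_support.2 fun h0 => by
      rw [h0, norm_zero] at hfl; linarith)
    exact ⟨x, hx.trans hρ, by rwa [add_apply_of_mem h₁.support hfar hd hx1]⟩
  · obtain ⟨x, hx, hst⟩ := h₁.strain
    have hA : 0 < R.A 0 := R.A_pos 0
    have hx1 : x ∈ tsupport U₁ := by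
      refine tsupport_fderiv_subset ℝ (subset_tsupport _ (mem_support.2 fun h0 => ?_))
      rw [h0, norm_zero] at hst
      linarith
    exact ⟨x, hx.trans hρ, by rwa [fderiv_add_of_mem h₁.smooth h₁.support h₂s hfar hd hx1]⟩
  · obtain ⟨x, γ, hx, hγ, hcl, hball, hspeed, hcirc⟩ := h₁.core
    exact ⟨x, γ, hx.trans hρ, hγ, hcl, hball, hspeed, by
      rwa [circulation_add_of_loop_of_le h₁.smooth h₂s hfar hdN hx hγ hball]⟩
  · intro x hx
    obtain ⟨hx1, hY1⟩ := mem_tsupport_of_norm_add_eq h₁.support hfar hd h₂lt hx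
    have ha := hm x hY1
    have hge := anchor_add_far_ge h₁.smooth h₁.support h₂s h₂c hdiv₂ hfar hd hx1
    rw [hY1] at hge
    linarith

end Slots

/-! ## §4 Translated amplifiers, and: far enough is always enough -/

section Translate

variable {R : TowerRates} {U₁ W : EuclideanSpace ℝ (Fin 3) → EuclideanSpace ℝ (Fin 3)} {ρ₁ ρ₂ d : ℝ}
  {c : EuclideanSpace ℝ (Fin 3)}
  (hW : ContDiff ℝ ∞ W) (hdivW : VectorCalculus.IsDivFree W) (hWsupp : tsupport W ⊆ closedBall 0 ρ₂)
  (hWlt : ∀ x, ‖W x‖ < R.Y 0) (hρ₂ : 0 ≤ ρ₂) (hdN : 1 / R.N 0 ≤ d) (hc : ρ₁ + d + ρ₂ < ‖c‖)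

include hW hdivW hWsupp hWlt hρ₂ hdN hc

/-- **STRICT SLOT AT `R`, translated amplifier**: a strict carrier at `R` with anchor values `≥ m` on its
argmax plus `W(· − c)` (`tsupport W ⊆ B̄(0, ρ₂)`, `ρ₂ ≥ 0`, speed `< Y₀(R)`) with `1/N₀(R) ≤ d`,
`ρ₁ + d + ρ₂ < ‖c‖` and `(3/(2πd⁴)) Y₀(R) ∫‖W‖² < m` is a strict-slot filler at `R` of radius `‖c‖ + ρ₂`.
[cite: Palasek2026ElementaryModel, §3.3] -/
theorem LevelZeroDataAt.add_translate (h₁ : LevelZeroDataAt R U₁ ρ₁) {m : ℝ}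
    (hm : ∀ x, ‖U₁ x‖ = R.Y 0 → m ≤ ⟪U₁ x, accel 1 U₁ x⟫)
    (hbudget : 3 / (2 * π * d ^ 4) * R.Y 0 * ∫ x, ‖W x‖ ^ 2 < m) :
    LevelZeroDataAt R (U₁ + fun x => W (x - c)) (‖c‖ + ρ₂) := by
  have hN := R.N_pos 0
  have hd : 0 < d := lt_of_lt_of_le (by positivity) hdN
  have hρ : ρ₁ ≤ ‖c‖ + ρ₂ := by linarith
  refine h₁.add_far (contDiff_translate c hW) (isDivFree_translate c hdivW)
    (tsupport_translate_subset c hWsupp) hρ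
    (far_of_translate c hWsupp hc) hdN (fun x => hWlt (x - c)) hm ?_
  rwa [integral_norm_sq_translate c]

end Translate

section Exists

variable {R : TowerRates} {U₁ W : EuclideanSpace ℝ (Fin 3) → EuclideanSpace ℝ (Fin 3)} {ρ₁ ρ₂ : ℝ}
  (hW : ContDiff ℝ ∞ W) (hdivW : VectorCalculus.IsDivFree W) (hWsupp : tsupport W ⊆ closedBall 0 ρ₂)
  (hWlt : ∀ x, ‖W x‖ < R.Y 0) (hρ₂ : 0 ≤ ρ₂)

include hW hdivW hWsupp hWlt hρ₂

omit hW hdivW hWsupp hWlt hρ₂ in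
/-- A distance making the energy × `d⁻⁴` budget at `R` smaller than any prescribed `m > 0`: for
`d ≥ max (1/N₀(R)) (1 + 3 Y₀(R) E / (2π m))`, `(3/(2πd⁴)) Y₀(R) E < m` (`E ≥ 0`). [folklore] -/
theorem budget_lt_of_le_at (R : TowerRates) {E m d : ℝ} (hE : 0 ≤ E) (hm : 0 < m)
    (hd : max (1 / R.N 0) (1 + 3 * R.Y 0 * E / (2 * π * m)) ≤ d) :
    3 / (2 * π * d ^ 4) * R.Y 0 * E < m := by
  have hY := R.Y_pos 0
  have hd1 : 1 + 3 * R.Y 0 * E / (2 * π * m) ≤ d := (le_max_right _ _).trans hd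
  have hq : 0 ≤ 3 * R.Y 0 * E / (2 * π * m) := by positivity
  have hd1' : 1 ≤ d := by linarith
  have hdpos : 0 < d := by linarith
  -- `d⁴ ≥ d`
  have hd4 : d ≤ d ^ 4 := by
    calc d = d * 1 := (mul_one d).symm
      _ ≤ d * d ^ 3 := by
          apply mul_le_mul_of_nonneg_left _ hdpos.le
          exact one_le_pow₀ hd1'
      _ = d ^ 4 := by ring
  -- `(3/(2π d)) Y₀ E < m` since `d > 3 Y₀ E/(2π m)`
  have hlt : 3 * R.Y 0 * E < 2 * π * m * d := by
    have h' : 3 * R.Y 0 * E / (2 * π * m) < d := by linarith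
    rw [div_lt_iff₀ (by positivity)] at h'
    linarith
  calc 3 / (2 * π * d ^ 4) * R.Y 0 * E
      ≤ 3 / (2 * π * d) * R.Y 0 * E := by gcongr
    _ = 3 * R.Y 0 * E / (2 * π * d) := by ring
    _ < m := by rw [div_lt_iff₀ (by positivity)]; linarith

/-- **EVERY AMPLIFIER, FAR ENOUGH, KEEPS A STRICT CARRIER AT `R` STRICT.** For a strict-slot carrier
`U₁` at the rates `R` and ANY smooth divergence-free `W` with `tsupport W ⊆ B̄(0, ρ₂)` (`ρ₂ ≥ 0`) and
speed `< Y₀(R)`, there is `r₀` such that `U₁ + W(· − c)` fills the strict slot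
`LevelZeroDataAt R · (‖c‖ + ρ₂)` for every `‖c‖ ≥ r₀` (the carrier's positive rising rate,
`LevelZeroDataAt.exists_rate`, absorbs the energy × `d⁻⁴` pressure push of `W`).
[cite: Palasek2026ElementaryModel, §3.3] [cite: GilbargTrudinger2001, Lemma 4.1] -/
theorem LevelZeroDataAt.exists_add_translate (h₁ : LevelZeroDataAt R U₁ ρ₁) :
    ∃ r₀ : ℝ, ∀ c : EuclideanSpace ℝ (Fin 3), r₀ ≤ ‖c‖ →
      LevelZeroDataAt R (U₁ + fun x => W (x - c)) (‖c‖ + ρ₂) := by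
  obtain ⟨m, hm, hmle⟩ := h₁.exists_rate
  set E := ∫ x, ‖W x‖ ^ 2 with hE
  have hE0 : 0 ≤ E := integral_nonneg fun x => by positivity
  set d := max (1 / R.N 0) (1 + 3 * R.Y 0 * E / (2 * π * m)) with hd
  refine ⟨ρ₁ + d + ρ₂ + 1, fun c hc => ?_⟩
  exact h₁.add_translate hW hdivW hWsupp hWlt hρ₂ (le_max_left _ _) (by linarith) hmle
    (budget_lt_of_le_at R hE0 hm le_rfl)

end Exists

end Summit.NavierStokesRegularity.FluidComputer.PalasekTowerClayBridge.Germ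

end
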